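import Summits.BirchSwinnertonDyer.BirchSwinnertonDyer.Theorems.CyclotomicUntwistAmiceInjective
import Summits.BirchSwinnertonDyer.BirchSwinnertonDyer.Theorems.CyclotomicUntwistGammaLeadingTerm
import HarnessLib

/-!
# The Amice transform is ADDITIVE and INJECTIVE on additive ball values of order `< 1`:
# `L_{μ+μ'} = L_μ + L_{μ'}`, and `L_μ = L_{μ'} ⟹ μ = μ'` — uniqueness of D1's object in power-series currency

Cell `pub/bsd-wall` (D-0145 line `route-BirchSwinnertonDyer-CyclotomicUntwist`), seat `bsd-line-cycu-p1`
(prover seat 1/3), helper toward crux K1 `PSRankOneLowerHalfAtThree` (stmt-BirchSwinnertonDyer-21580), D1/D3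
currency; capstone of the Amice lane (`CyclotomicUntwistMahlerTail`, `…AmiceInjective`, `…AmiceCharValues`,
`…AmiceInterpolation`, `…AmiceZeros`, `…AmiceRankOne`, `…AmiceOrderOne`).  THEOREMS ONLY (no definition, no
named fact, no `sorry`); BSD is not proved by this file and no crux is.

* `gammaRiemannSum_add_system`, `gammaMahlerCoeff_add`, `gammaAmiceTransform_add`, `gammaMahlerCoeff_neg`,
  `gammaAmiceTransform_neg`, `gammaAmiceTransform_sub` — linearity in the ball values (order `< 1`; scalars are
  `PSGammaLeadingTerm.gammaAmiceTransform_smul`);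
* `eq_of_gammaAmiceTransform_eq` — **two additive systems of orders `ν, ν' < 1` with the same Amice transform
  are EQUAL** (injectivity `gammaAmiceTransform_ne_zero` applied to the difference); for the route:
  `eq_of_gammaAmiceTransform_eq_of_isPSCyclotomicLFunctionOf` — two objects with D1's property (any data
  `(W, η, α)`, `(W', η', α')`) and the same power series coincide ball by ball.  With the tree's
  `PSGammaUniqueness.eq_of_isUntwistedPAdicLFunction` (same data ⇒ same balls) this closes the circle: on the
  order-`< 1` class, ball values, character values (all levels) and the Amice power series are three faithful
  encodings of one object.

References: [cite: MazurTateTeitelbaum1986Invent, §I.11 and §I.13]; [cite: Bellaiche2021, Thm. 6.2.13].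
-/

noncomputable section

open Filter Topology Literature.NumberTheory.IwasawaTheory
  Summit.BirchSwinnertonDyer.BirchSwinnertonDyer.Theorems.PSAmiceInjective

-- single-conjunct summit: `Summit.BirchSwinnertonDyer.BirchSwinnertonDyer.…` repeats the name by design
set_option linter.dupNamespace false
set_option autoImplicit false

namespace Summit.BirchSwinnertonDyer.BirchSwinnertonDyer.Theorems.PSAmiceUniqueness

variable {p : ℕ} [hp : Fact p.Prime]

/-! ### §1 Additivity in the ball values -/

section Additive

variable {μ μ' : (n : ℕ) → ZMod (p ^ n) → ℂ_[p]}

/-- Riemann sums are additive in the ball values. [cite: MazurTateTeitelbaum1986Invent, §I.13] -/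
theorem gammaRiemannSum_add_system (μ μ' : (n : ℕ) → ZMod (p ^ n) → ℂ_[p]) (φ : ℕ → ℂ_[p]) (n : ℕ) :
    gammaRiemannSum p (fun n s ↦ μ n s + μ' n s) φ n =
      gammaRiemannSum p μ φ n + gammaRiemannSum p μ' φ n := by
  simp only [gammaRiemannSum_def, mul_add, Finset.sum_add_distrib]

/-- Riemann sums of the negated ball values. [cite: MazurTateTeitelbaum1986Invent, §I.13] -/
theorem gammaRiemannSum_neg_system (μ : (n : ℕ) → ZMod (p ^ n) → ℂ_[p]) (φ : ℕ → ℂ_[p]) (n : ℕ) :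
    gammaRiemannSum p (fun n s ↦ -μ n s) φ n = -gammaRiemannSum p μ φ n := by
  simp only [gammaRiemannSum_def, mul_neg, Finset.sum_neg_distrib]

/-- **Mahler coefficients are additive** (orders `ν, ν' < 1`): `c_k(μ + μ') = c_k(μ) + c_k(μ')` (limits of
additive Riemann sums; the sum has order `max ν ν' < 1`). [cite: MazurTateTeitelbaum1986Invent, §I.13] -/
theorem gammaMahlerCoeff_add (hμ : IsGammaDistribution p μ) {ν : ℝ} (hν : HasGrowthOrder p ν μ)
    (hν1 : ν < 1) (hμ' : IsGammaDistribution p μ') {ν' : ℝ} (hν' : HasGrowthOrder p ν' μ')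
    (hν'1 : ν' < 1) (k : ℕ) :
    gammaMahlerCoeff p (fun n s ↦ μ n s + μ' n s) k = gammaMahlerCoeff p μ k + gammaMahlerCoeff p μ' k := by
  have hsum : HasGrowthOrder p (max ν ν') (fun n s ↦ μ n s + μ' n s) :=
    (hν.mono (le_max_left _ _)).add (hν'.mono (le_max_right _ _))
  refine tendsto_nhds_unique
    (tendsto_gammaRiemannSum_gammaMahlerCoeff (hμ.add hμ') hsum (max_lt hν1 hν'1) k) ?_
  have h := (tendsto_gammaRiemannSum_gammaMahlerCoeff hμ hν hν1 k).add
    (tendsto_gammaRiemannSum_gammaMahlerCoeff hμ' hν' hν'1 k)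
  exact h.congr fun n ↦ (gammaRiemannSum_add_system μ μ' _ n).symm

/-- **Mahler coefficients of `−μ`**. [cite: MazurTateTeitelbaum1986Invent, §I.13] -/
theorem gammaMahlerCoeff_neg (hμ : IsGammaDistribution p μ) {ν : ℝ} (hν : HasGrowthOrder p ν μ)
    (hν1 : ν < 1) (k : ℕ) :
    gammaMahlerCoeff p (fun n s ↦ -μ n s) k = -gammaMahlerCoeff p μ k := by
  refine tendsto_nhds_unique (tendsto_gammaRiemannSum_gammaMahlerCoeff hμ.neg hν.neg hν1 k) ?_
  have h := (tendsto_gammaRiemannSum_gammaMahlerCoeff hμ hν hν1 k).neg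
  exact h.congr fun n ↦ (gammaRiemannSum_neg_system μ _ n).symm

/-- **The Amice transform is additive**: `L_{μ+μ'} = L_μ + L_{μ'}` (orders `< 1`).
[cite: MazurTateTeitelbaum1986Invent, §I.13] -/
theorem gammaAmiceTransform_add (hμ : IsGammaDistribution p μ) {ν : ℝ} (hν : HasGrowthOrder p ν μ)
    (hν1 : ν < 1) (hμ' : IsGammaDistribution p μ') {ν' : ℝ} (hν' : HasGrowthOrder p ν' μ')
    (hν'1 : ν' < 1) :
    gammaAmiceTransform p (fun n s ↦ μ n s + μ' n s) = gammaAmiceTransform p μ + gammaAmiceTransform p μ' := by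
  ext k
  rw [map_add, coeff_gammaAmiceTransform, coeff_gammaAmiceTransform, coeff_gammaAmiceTransform,
    gammaMahlerCoeff_add hμ hν hν1 hμ' hν' hν'1 k]

/-- **The Amice transform of `−μ`**. [cite: MazurTateTeitelbaum1986Invent, §I.13] -/
theorem gammaAmiceTransform_neg (hμ : IsGammaDistribution p μ) {ν : ℝ} (hν : HasGrowthOrder p ν μ)
    (hν1 : ν < 1) : gammaAmiceTransform p (fun n s ↦ -μ n s) = -gammaAmiceTransform p μ := by
  ext k
  rw [map_neg, coeff_gammaAmiceTransform, coeff_gammaAmiceTransform, gammaMahlerCoeff_neg hμ hν hν1 k]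

/-- **The Amice transform of a difference**: `L_{μ−μ'} = L_μ − L_{μ'}` (orders `< 1`).
[cite: MazurTateTeitelbaum1986Invent, §I.13] -/
theorem gammaAmiceTransform_sub (hμ : IsGammaDistribution p μ) {ν : ℝ} (hν : HasGrowthOrder p ν μ)
    (hν1 : ν < 1) (hμ' : IsGammaDistribution p μ') {ν' : ℝ} (hν' : HasGrowthOrder p ν' μ')
    (hν'1 : ν' < 1) :
    gammaAmiceTransform p (fun n s ↦ μ n s - μ' n s) = gammaAmiceTransform p μ - gammaAmiceTransform p μ' := by
  have h := gammaAmiceTransform_add hμ hν hν1 hμ'.neg hν'.neg hν'1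
  rw [gammaAmiceTransform_neg hμ' hν' hν'1] at h
  simpa only [sub_eq_add_neg] using h

end Additive

/-! ### §2 Injectivity: the power series determines the ball values -/

section Injective

variable {μ μ' : (n : ℕ) → ZMod (p ^ n) → ℂ_[p]}

/-- **`L_μ = L_{μ'} ⟹ μ = μ'`** for additive ball values of orders `ν, ν' < 1`: the difference is additive of
order `max ν ν' < 1` with Amice transform `0`, hence zero ball by ball (`eq_zero_of_forall_gammaMahlerCoeff_eq_zero`).
[cite: Bellaiche2021, Thm. 6.2.13] [cite: MazurTateTeitelbaum1986Invent, §I.13] -/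
theorem eq_of_gammaAmiceTransform_eq (hμ : IsGammaDistribution p μ) {ν : ℝ} (hν : HasGrowthOrder p ν μ)
    (hν1 : ν < 1) (hμ' : IsGammaDistribution p μ') {ν' : ℝ} (hν' : HasGrowthOrder p ν' μ')
    (hν'1 : ν' < 1) (h : gammaAmiceTransform p μ = gammaAmiceTransform p μ') : μ = μ' := by
  have hδ : IsGammaDistribution p (fun n s ↦ μ n s - μ' n s) := by
    have h' := hμ.add hμ'.neg
    simpa only [sub_eq_add_neg] using h'
  have hδg : HasGrowthOrder p (max ν ν') (fun n s ↦ μ n s - μ' n s) := by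
    have h' := (hν.mono (le_max_left ν ν')).add ((hν'.mono (le_max_right ν ν')).neg)
    simpa only [sub_eq_add_neg] using h'
  have hA : gammaAmiceTransform p (fun n s ↦ μ n s - μ' n s) = 0 := by
    rw [gammaAmiceTransform_sub hμ hν hν1 hμ' hν' hν'1, h, sub_self]
  funext n s
  have hz := eq_zero_of_forall_gammaMahlerCoeff_eq_zero hδ hδg (max_lt hν1 hν'1) (fun k ↦ by
    have := congrArg (PowerSeries.coeff k) hA
    simpa using this) n s
  exact sub_eq_zero.1 hz

/-- **For the route**: two systems with D1's property — for ANY data `(W, η, α)` and `(W', η', α')` — that have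
the same Amice power series are equal ball by ball (both are additive of order `½`).
[cite: Bellaiche2021, Thm. 6.2.13] [cite: MazurTateTeitelbaum1986Invent, §I.14] -/
theorem eq_of_gammaAmiceTransform_eq_of_isPSCyclotomicLFunctionOf {W W' : WeierstrassCurve ℚ}
    {η η' : DirichletCharacter ℂ_[3] (3 ^ 2)} {α α' : ℂ_[3]} {μ μ' : (n : ℕ) → ZMod (3 ^ n) → ℂ_[3]}
    (hμ : IsPSCyclotomicLFunctionOf W η α μ) (hμ' : IsPSCyclotomicLFunctionOf W' η' α' μ')
    (h : gammaAmiceTransform 3 μ = gammaAmiceTransform 3 μ') : μ = μ' := by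
  obtain ⟨h1, h2⟩ := hμ.isGammaDistribution_and_hasGrowthOrder
  obtain ⟨h1', h2'⟩ := hμ'.isGammaDistribution_and_hasGrowthOrder
  exact eq_of_gammaAmiceTransform_eq h1 h2 (by norm_num) h1' h2' (by norm_num) h

end Injective

end Summit.BirchSwinnertonDyer.BirchSwinnertonDyer.Theorems.PSAmiceUniqueness

end
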